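import Literature.MathematicalPhysics.QuantumFieldTheory.Balaban1983to89.B9Thm313WholeCutLettersSupFrom344
import Literature.MathematicalPhysics.QuantumFieldTheory.Balaban1983to89.B9SmoothHolderClassTClosure

/-!
# `Balaban1983to89.B9Thm313WholeCutLettersGXHAtPinsT` — [B9] Theorem 3.13 (p. 426): the re-cut letter `Letters313Zc.gXH` (G₁∇\*_U : 𝔠_Y⁽⁰⁾ → `bXH`) AT THE
# OPTION (2) BOND PIN `bXH := bHZKT (taxiB U) β₀ 1` ∕ the graded `bHZKG (taxiB U) 1 w` — from Theorem 3.3's (3.42)₃ ∕ (3.43)₂ for G₀, the steps, `Identities`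
# and the PIN EQUATIONS, with NO class axiom left (`hXcl` is `B9SmoothHolderClassTClosure.hXcl_bHZKT`)

T. Bałaban, *Propagators for lattice gauge theories in a background field*, Commun. Math. Phys. **99** (1985) 389–434
[`Balaban1985BackgroundPropagators`, "B9"]; [4] = T. Bałaban, *Propagators and renormalization transformations for lattice gauge
theories. II*, Commun. Math. Phys. **96** (1984) 223–250 [`Balaban1984PropagatorsII`].

statement-level skeleton of published theorems with citation tags; proofs where landed; nothing here is a claim about the
Yang–Mills mass gap

THE PRINTED LOCI.  [B9] Thm 3.12 p. 423 + (3.138) p. 423 (G₁ = G₀ − G₀(T_π + T₂)G₁: the two words print reads G₁∇\*_U in), (3.42)₃ ∕ (3.43)₂ pp. 397–398 for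
G₀ = G(U) (Thm 3.3 p. 399), Thm 3.13 p. 426 (𝔊's letters), (3.40) p. 397 (the covariant Hölder quotient); [4] (2.51)–(2.54) pp. 232–233, Lemma 2.1 (2.61) p. 234.

WHY THIS FILE (cell `pub-ymgap`, node N06, seat dag-n06-l g22; sequel of `B9Thm313WholeCutLettersSupFrom344` (g19) and `B9SmoothHolderClassTClosure` (g22)).
g19's `gXH_of_closure` reduced the re-cut schema's letter `Letters313Zc.gXH` to printed-species G₀ material PLUS the closure axiom `hXcl` of the free class `bXH`
(constants adding exactly, same rate).  At the option-(2) pin the closure is a THEOREM with an honest factor (`L` on the sup constant, `e^{r(r_near+1)}` from the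
enlarged block).  THIS FILE:
* §1 ★ `gXH_of_closureE` — g19's theorem VERBATIM with a FACTOR-TOLERANT closure binder `hXclE` (into `bXH` with `(E·(C + C_b))·e^{r·r_X}·e^{−rd}`, `E ≥ 1`,
  any real `r_X`): `B₃ ≥ E·e^{ρ r_X}·(A₁ + (B_h + θ_H A₁ c))`, `δ₃ ≤ ρ` (A₁ = B₀(1 − θc)⁻¹);
* §2 ★★ `gXH_bHZKT_of_pins` — at `bXH := bHZKT i b g β₀ 1` under the PIN EQUATIONS `𝔬.blk = blkBK bI`, `𝔭.blkPX = blkPK bI`, `𝔭.ΦX U β₀ = probeK b g (wKA β₀) (w₀K β₀)`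
  (the certificate's `holderProbesKA … (parBY) bI` at the table `g := taxiB U`, `B9SmoothHolderClassTClosure.ΦX_holderProbesKA_parBY`): `Letters313Zc.gXH`'s statement
  from `he2 h43 hK hpX hI` and the certificate's carrier binders `hβ1 hlev hbI0 hcfk` — NO class axiom: `E := L`, `r_X := r_near + 1`;
* §3 ★★ `gXH_bHZKG_of_pins` — the same INTO THE GRADED PIN `bHZKG i b g 1 w` from the ∀ s ∈ (0,1) families `h43 s` ((3.43)₂ with `B_h(s) → ∞` allowed), `hpX s`,
  `hΦ s`, under the weight condition `w s·(B_h s + θ_H s·A₁·c) ≤ B_H` (LOCATED-U5: the producer lands ONCE): `B₃ ≥ L·e^{ρ(r_near+1)}·(A₁ + B_H)`.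
NET: with p654420 (`hκX`, `hX`) all THREE class axioms of the re-cut letters are theorems at the graded transported bond pin, and `gXH` there is rows-19 G₀ material
((3.42)₃, (3.43)₂ at node00-def-Y's covariant probes) + the displayed steps + `Identities`.
HONEST SCOPE.  Kernel bookkeeping over landed schemas; NOTHING of print's estimates is asserted — (3.42)₃ ∕ (3.43)₂ for G₀, the steps and `Identities` are HYPOTHESES of
printed species; no certificate edit; COUNT-NEUTRAL; N06 NOT discharged; one finite lattice at a time; nothing continuum, nothing about the mass gap ∕ Clay.
Cell `pub-ymgap` (HUMAN RULING D-0062), Track A node N06 [B9], bundle F7 rows 20–21, seat `pub-ymgap-dag-n06-l` (g22), 2026-08-28.  NEW file.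
-/

namespace Literature.MathematicalPhysics.QuantumFieldTheory.Balaban1983to89.B9Thm313WholeCutLettersGXHAtPinsT

open Finset B6RandomWalk B6RandomWalkHom B9Thm34Ext B11SectG B9SectDSup B9SectDL2Decay B9Thm37Glue B9Thm312Whole
open B9Thm312WholeClasses B9RWSums343to347Whole B9RWSums343Holder B9PerturbationMajorantAlgebra B9PerturbationMajorantLetters
open B9Thm313WholeRgdFrom3152 B9Thm312WholeLeaf B9Thm312WholeHolder B9Thm312WholeHHolder B9Thm313WholeHolder B9Thm313Whole
open B9Thm313WholeCutLettersSupFrom344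

noncomputable section

section Generic

variable {g : B9.Geometry} {B : B9.Backgrounds} {X Y Z W PX PY : Type} [Fintype X] [Fintype Y] [Fintype Z] [Fintype W] [Fintype PX]
  [Fintype g.Site]
variable {R₀ : ℝ} {H₀ : Prop}

/-! ## §1 `gXH` from a factor-tolerant closure -/

/-- ★ **`Letters313Zc.gXH` FROM ITS TWO PRINTED COMPONENTS AND A FACTOR-TOLERANT CLOSURE** — `B9Thm313WholeCutLettersSupFrom344.gXH_of_closure` VERBATIM except the
closure binder: `hXclE` bounds an operator out of `𝔠_Y⁽⁰⁾` into `bXH` with `(E·(C + C_b))·e^{r·r_X}·e^{−rd}` (`E ≥ 1` — the honest enlargement cost of a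
smooth-partition class, `B9SmoothHolderClassTClosure.hXcl_bHZKT`: `E = L`, `r_X = r_near + 1`; any real `r_X`) instead of `(C + C_b)·e^{−rd}`.  Conclusion: G₁∇\*_U : 𝔠_Y⁽⁰⁾ → bXH with
any `B₃ ≥ E·e^{ρ r_X}·(A₁ + (B_h + θ_H A₁ c))` at any rate `δ₃ ≤ ρ` (`0 ≤ ρ ≤ δ₀`, `ρ + σ ≤ δ_K`, `θc < 1`, A₁ = B₀(1 − θc)⁻¹).  Nothing of print asserted.
[cite: Balaban1985BackgroundPropagators, Thm 3.12 p.423 + (3.138) p.423 + (3.42)–(3.43) pp.397–398 + Thm 3.13 p.426; Balaban1984PropagatorsII, (2.52)–(2.56) pp.232–233 + Lemma 2.1 (2.61) p.234] -/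
theorem gXH_of_closureE (hG : GeoOK g) {σ c : ℝ} (hrow : RowSum (toB6 g R₀ H₀) σ c) {𝔬 : Ops g B X Y Z W} (𝔭 : HolderProbes g B X Y PX PY)
    {U : B.Cfg} {bXH : BlockNorm (toB6 g R₀ H₀) (X → ℝ)} {θ θH B₀ Bh β₀ δ₀ δK ρ B₃ δ₃ E rX : ℝ}
    (hc : 0 ≤ c) (hθ : 0 ≤ θ) (hθH : 0 ≤ θH) (hB₀ : 0 ≤ B₀) (hBh : 0 ≤ Bh) (hρ : 0 ≤ ρ) (hρS : ρ ≤ δ₀) (hρδ : ρ + σ ≤ δK) (hq : θ * c < 1)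
    (hE : 1 ≤ E)
    (hK : HasMaj (cNorm R₀ H₀ 𝔬.blk hG.lenle 1) (cNorm R₀ H₀ 𝔬.blk hG.lenle 1) (𝔬.G0 U ∘ₗ (𝔬.Tpi U + 𝔬.T2 U))
      (fun a b => θ * Real.exp (-(δK * g.dist a b))))
    (he2 : HasMajorantHom (g := toB6 g R₀ H₀) 𝔬.blkY 𝔬.blk (𝔬.G0 U ∘ₗ 𝔬.Dstar U)
      (fun a b => B₀ * g.len a * Real.exp (-(δ₀ * g.dist a b))))
    (h43 : HasMajorantHom (g := toB6 g R₀ H₀) 𝔬.blkY 𝔭.blkPX (𝔭.ΦX U β₀ ∘ₗ (𝔬.G0 U ∘ₗ 𝔬.Dstar U))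
      (fun (a b : g.Site) => Bh * g.len a ^ (1 - β₀) * Real.exp (-(δ₀ * g.dist a b))))
    (hpX : HasMaj (cNormR R₀ H₀ 𝔬.blk hG.lenle (-1)) (cNormR R₀ H₀ 𝔭.blkPX hG.lenle (β₀ - 1))
      ((𝔭.ΦX U β₀ ∘ₗ 𝔬.G0 U) ∘ₗ (𝔬.Tpi U + 𝔬.T2 U)) (fun a b => θH * Real.exp (-(δK * g.dist a b))))
    (hI : Identities 𝔬 U)
    (hXclE : ∀ (T : (Y → ℝ) →ₗ[ℝ] (X → ℝ)) (C Cb r : ℝ), 0 ≤ C → 0 ≤ Cb → 0 ≤ r →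
      HasMaj (cNorm R₀ H₀ 𝔬.blkY hG.lenle 0) (cNorm R₀ H₀ 𝔬.blk hG.lenle 1) T (fun a b => C * Real.exp (-(r * g.dist a b))) →
      HasMaj (cNormR R₀ H₀ 𝔬.blkY hG.lenle 0) (cNormR R₀ H₀ 𝔭.blkPX hG.lenle (β₀ - 1)) (𝔭.ΦX U β₀ ∘ₗ T)
        (fun a b => Cb * Real.exp (-(r * g.dist a b))) →
      HasMaj (cNorm R₀ H₀ 𝔬.blkY hG.lenle 0) bXH T (fun a b => (E * (C + Cb)) * Real.exp (r * rX) * Real.exp (-(r * g.dist a b))))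
    (hB₃ : E * Real.exp (ρ * rX) * (B₀ * (1 - θ * c)⁻¹ + (Bh + θH * (B₀ * (1 - θ * c)⁻¹) * c)) ≤ B₃) (hδ₃ : δ₃ ≤ ρ) :
    HasMaj (cNorm R₀ H₀ 𝔬.blkY hG.lenle 0) bXH (𝔬.G1 U ∘ₗ 𝔬.Dstar U) (fun a b => B₃ * Real.exp (-(δ₃ * g.dist a b))) := by
  have hinv : 0 ≤ (1 - θ * c)⁻¹ := inv_nonneg.mpr (by linarith)
  have hA₁ : 0 ≤ B₀ * (1 - θ * c)⁻¹ := mul_nonneg hB₀ hinv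
  have hfix1 := fix_of_inverses hI.invG0' hI.invG1
  -- the sup component: (3.42)₃ for G₁
  have hsup := hasMaj_entry2_cNorm hG hrow hθ hB₀ hρ hρS hρδ hK he2 hfix1 hq
  have hG1 : HasMaj (cNormR R₀ H₀ 𝔬.blkY hG.lenle 0) (cNormR R₀ H₀ 𝔬.blk hG.lenle (-1)) (𝔬.G1 U ∘ₗ 𝔬.Dstar U)
      (fun a b => B₀ * (1 - θ * c)⁻¹ * Real.exp (-(ρ * g.dist a b))) := by
    have h := hasMaj_toR hG hsup
    simp only [Nat.cast_zero, neg_zero, Nat.cast_one] at h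
    exact h
  -- the probe component: (3.43)₂ for G₁ (the head E G₀∇* from the G₀-probe, then the probe step)
  set EE : (X → ℝ) →ₗ[ℝ] (PX → ℝ) := 𝔭.ΦX U β₀ with hEE
  set bout := cNormR R₀ H₀ 𝔭.blkPX hG.lenle (β₀ - 1) with hbout
  have hE0 : HasMaj (cNormR R₀ H₀ 𝔬.blkY hG.lenle 0) bout (EE ∘ₗ 𝔬.G0 U ∘ₗ 𝔬.Dstar U) (fun a b => Bh * Real.exp (-(δ₀ * g.dist a b))) := by
    have h := hasMaj_cNormR_of_hasMajorantHom hG (C := fun a b => Bh * Real.exp (-(δ₀ * g.dist a b)))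
      (fun a b => mul_nonneg hBh (Real.exp_nonneg _)) (1 - β₀) 0
      (hasMajorantHom_mono (g := toB6 g R₀ H₀) 𝔬.blkY 𝔭.blkPX h43 fun a b => le_of_eq (by simp only [Real.rpow_zero, mul_one]; ring))
    have e : -(1 - β₀) = β₀ - 1 := by ring
    rw [e] at h
    exact h
  have hKE : HasMaj (cNormR R₀ H₀ 𝔬.blk hG.lenle (-1)) bout (EE ∘ₗ 𝔬.G0 U ∘ₗ (𝔬.Tpi U + 𝔬.T2 U))
      (fun a b => θH * Real.exp (-(δK * g.dist a b))) := hpX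
  have hD1 : HasMaj (cNormR R₀ H₀ 𝔬.blkY hG.lenle 0) bout (EE ∘ₗ 𝔬.G1 U ∘ₗ 𝔬.Dstar U)
      (fun y y' => (Bh + θH * (B₀ * (1 - θ * c)⁻¹) * c) * Real.exp (-(ρ * g.dist y y'))) :=
    hasMaj_left_rightR hG hrow hθH hBh hA₁ hρ hρS le_rfl hρδ hKE hE0 hG1 hfix1
  -- the class below the maximum of the two, with its honest factor
  have hCb0 : 0 ≤ Bh + θH * (B₀ * (1 - θ * c)⁻¹) * c := add_nonneg hBh (mul_nonneg (mul_nonneg hθH hA₁) hc)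
  have h := hXclE (𝔬.G1 U ∘ₗ 𝔬.Dstar U) (B₀ * (1 - θ * c)⁻¹) (Bh + θH * (B₀ * (1 - θ * c)⁻¹) * c) ρ hA₁ hCb0 hρ hsup hD1
  have hE0' : 0 ≤ E := zero_le_one.trans hE
  have hC0 : 0 ≤ E * Real.exp (ρ * rX) * (B₀ * (1 - θ * c)⁻¹ + (Bh + θH * (B₀ * (1 - θ * c)⁻¹) * c)) := by positivity
  exact hasMaj_weaken hG hC0 hB₃ hδ₃ (h.mono fun a b => le_of_eq (by ring))

end Generic

/-! ## §2 ★★ At the transported bond pin: no class axiom -/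

section Pins

open B6GlobalChartV1 (PV blkV1)
open B6Ineq2142KLevelV1 (β lvl)
open B6KLevelCensusIndexV1 (KIdx)
open B6Geom246MultiLevelTorus (geomT)
open B9GeoNormsKLevelV1 (geo9K)
open B9CoReadingCoords (XBK blkBK)
open B9CoReadingCoordsHolder (PK blkPK probeK wK w₀K)
open B9CoReadingCoordsHolderAdm (wKA)
open B9MultiscaleSmoothPartitionYNear (rNear)
open B9SmoothHolderClassT (bHZKT)
open B9SmoothHolderClassGraded (bHZKG hasMaj_into_bHZKG)
open B9SmoothHolderClassTClosure (hXcl_bHZKT abs_cf_eq_nKT)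
open Node00 (SiteY FBondY IBondY toKT)

variable {d ℓ : ℕ} {hd : 1 ≤ d + 1} {hL : Odd (ℓ + 1) ∧ 1 < ℓ + 1} {b₀ b₁ : ℝ}
variable {𝔸 : Type} [NormedRing 𝔸] [NormedAlgebra ℂ 𝔸]
variable {κ : Type} [Fintype κ]
variable (i : KIdx d ℓ hd hL b₀ b₁) [Fintype (geo9K i).Site] (b : Module.Basis κ ℝ 𝔸) (gt : FBondY i → FBondY i → 𝔸ˣ)
variable {B : B9.Backgrounds} {Y Z W PY : Type} [Fintype Y] [Fintype Z] [Fintype W]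
variable {R₀ : ℝ} {H₀ : Prop}

/-- ★★ **THE RE-CUT LETTER G₁∇\*_U : 𝔠_Y⁽⁰⁾ → `bXH` AT THE PIN `bXH := bHZKT g β₀ 1` — NO CLASS AXIOM.**  Under the certificate's pin equations (`𝔬.blk = blkBK bI`,
`𝔭.blkPX = blkPK bI`, `𝔭.ΦX U β₀ = probeK b g (wKA β₀) (w₀K β₀)` — `holderProbesKA`'s family along the class's own table `g`, e.g. `taxiB U` at def-Y's `parBY`) and its
carrier binders (`hβ1 hlev hbI0`, print's units `hcfk`), `Letters313Zc.gXH`'s statement follows from Theorem 3.3's (3.42)₃ `he2` and (3.43)₂ `h43` for G₀, the steps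
`hK ∕ hpX` and `Identities`, by §1 with the closure THEOREM `B9SmoothHolderClassTClosure.hXcl_bHZKT` (`E := L`, `r_X := r_near + 1`): any
`B₃ ≥ L·e^{ρ(r_near+1)}·(A₁ + (B_h + θ_H A₁ c))`, any `δ₃ ≤ ρ`. [cite: Balaban1985BackgroundPropagators, Thm 3.13 p.426 + Thm 3.12 p.423 ((3.138)) + (3.40)–(3.43) pp.397–398; Balaban1984PropagatorsII, (2.51)–(2.56) pp.232–233 + Lemma 2.1 (2.61) p.234] -/
theorem gXH_bHZKT_of_pins (hG : GeoOK (geo9K i)) {σ c : ℝ} (hrow : RowSum (toB6 (geo9K i) R₀ H₀) σ c)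
    {𝔬 : Ops (geo9K i) B (XBK κ i) Y Z W} (𝔭 : HolderProbes (geo9K i) B (XBK κ i) Y (PK (FBondY i) (Fin (d + 1)) κ) PY)
    {U : B.Cfg} {θ θH B₀ Bh β₀ δ₀ δK ρ B₃ δ₃ : ℝ} (hβ0 : 0 ≤ β₀) (hβ1 : β₀ ≤ 1)
    (hc : 0 ≤ c) (hθ : 0 ≤ θ) (hθH : 0 ≤ θH) (hB₀ : 0 ≤ B₀) (hBh : 0 ≤ Bh) (hρ : 0 ≤ ρ) (hρS : ρ ≤ δ₀) (hρδ : ρ + σ ≤ δK) (hq : θ * c < 1)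
    {bI : FBondY i → IBondY i}
    (hβ1f : ∀ f : FBondY i, (geomT i.D).dist (β i.hN i.D i.hk (bI f)) (blkV1 i.hN i.D f) ≤ 1)
    (hlev : ∀ f : FBondY i, lvl i.hN i.D i.hk (bI f) = (blkV1 i.hN i.D f).1.1) (hbI0 : ∀ f : FBondY i, bI f = bI ⟨f.src, 0⟩)
    (hcfk : i.cf = (((ℓ + 1 : ℕ) : ℝ)) ^ i.k)
    (hblk : 𝔬.blk = blkBK i bI) (hPX : 𝔭.blkPX = blkPK bI) (hΦ : 𝔭.ΦX U β₀ = probeK b gt (wKA i β₀) (w₀K i β₀))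
    (hK : HasMaj (cNorm R₀ H₀ 𝔬.blk hG.lenle 1) (cNorm R₀ H₀ 𝔬.blk hG.lenle 1) (𝔬.G0 U ∘ₗ (𝔬.Tpi U + 𝔬.T2 U))
      (fun a b => θ * Real.exp (-(δK * (geo9K i).dist a b))))
    (he2 : HasMajorantHom (g := toB6 (geo9K i) R₀ H₀) 𝔬.blkY 𝔬.blk (𝔬.G0 U ∘ₗ 𝔬.Dstar U)
      (fun a b => B₀ * (geo9K i).len a * Real.exp (-(δ₀ * (geo9K i).dist a b))))
    (h43 : HasMajorantHom (g := toB6 (geo9K i) R₀ H₀) 𝔬.blkY 𝔭.blkPX (𝔭.ΦX U β₀ ∘ₗ (𝔬.G0 U ∘ₗ 𝔬.Dstar U))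
      (fun (a b : (geo9K i).Site) => Bh * (geo9K i).len a ^ (1 - β₀) * Real.exp (-(δ₀ * (geo9K i).dist a b))))
    (hpX : HasMaj (cNormR R₀ H₀ 𝔬.blk hG.lenle (-1)) (cNormR R₀ H₀ 𝔭.blkPX hG.lenle (β₀ - 1))
      ((𝔭.ΦX U β₀ ∘ₗ 𝔬.G0 U) ∘ₗ (𝔬.Tpi U + 𝔬.T2 U)) (fun a b => θH * Real.exp (-(δK * (geo9K i).dist a b))))
    (hI : Identities 𝔬 U)
    (hB₃ : (((ℓ + 1 : ℕ) : ℝ)) * Real.exp (ρ * (rNear d ℓ + 1)) * (B₀ * (1 - θ * c)⁻¹ + (Bh + θH * (B₀ * (1 - θ * c)⁻¹) * c)) ≤ B₃) (hδ₃ : δ₃ ≤ ρ) :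
    HasMaj (cNorm R₀ H₀ 𝔬.blkY hG.lenle 0) (bHZKT (κ := κ) i b gt (R := R₀) (H := H₀) hβ0 hβ1 hβ1) (𝔬.G1 U ∘ₗ 𝔬.Dstar U)
      (fun a b => B₃ * Real.exp (-(δ₃ * (geo9K i).dist a b))) := by
  have hL1 : (1 : ℝ) ≤ ((ℓ + 1 : ℕ) : ℝ) := by exact_mod_cast Nat.succ_le_succ (Nat.zero_le ℓ)
  refine gXH_of_closureE hG hrow 𝔭 hc hθ hθH hB₀ hBh hρ hρS hρδ hq hL1 hK he2 h43 hpX hI ?_ hB₃ hδ₃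
  -- the closure at the transported pin, rewritten through the pin equations
  intro T C Cb r hC hCb hr hsupT hprT
  rw [hblk] at hsupT
  rw [hPX, hΦ] at hprT
  have h := hXcl_bHZKT i b gt hG.lenle hβ0 hβ1 hβ1f hlev hbI0 (abs_cf_eq_nKT i hcfk) 𝔬.blkY T hC hCb hr hsupT hprT
  refine h.mono fun a a' => ?_
  have he : 0 ≤ Real.exp (r * (rNear d ℓ + 1)) * Real.exp (-(r * (geo9K i).dist a a')) := by positivity
  have hcoef : (((ℓ + 1 : ℕ) : ℝ)) * C + Cb ≤ ((ℓ + 1 : ℕ) : ℝ) * (C + Cb) := by nlinarith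
  calc ((((ℓ + 1 : ℕ) : ℝ)) * C + Cb) * Real.exp (r * (rNear d ℓ + 1)) * Real.exp (-(r * (geo9K i).dist a a'))
      = ((((ℓ + 1 : ℕ) : ℝ)) * C + Cb) * (Real.exp (r * (rNear d ℓ + 1)) * Real.exp (-(r * (geo9K i).dist a a'))) := by ring
    _ ≤ (((ℓ + 1 : ℕ) : ℝ) * (C + Cb)) * (Real.exp (r * (rNear d ℓ + 1)) * Real.exp (-(r * (geo9K i).dist a a'))) :=
        mul_le_mul_of_nonneg_right hcoef he
    _ = _ := by ring

/-! ## §3 ★★ Into the GRADED pin: the producer lands once -/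

/-- ★★ **`Letters313Zc.gXH` AT THE GRADED PIN `bXH := bHZKG g 1 w`** (LOCATED-U5: the class floats its exponent, the producer lands ONCE).  Data: the sup word (3.42)₃
`he2` and the step `hK` (exponent-free), and FOR EVERY `s ∈ (0,1)` the probe words `h43 s` ((3.43)₂ for G₀ with constant `B_h s`, `B₀(β) → ∞` allowed), `hpX s`
(probe step, `θ_H s`) and the pin equation `hΦ s`; the weight absorbs the exponent-dependent constants: `w s·(B_h s + θ_H s·A₁·c) ≤ B_H`.  Conclusion: G₁∇\*_U :
𝔠_Y⁽⁰⁾ → `bHZKG g 1 w` with any `B₃ ≥ L·e^{ρ(r_near+1)}·(A₁ + B_H)`, any `δ₃ ≤ ρ`.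
[cite: Balaban1985BackgroundPropagators, Thm 3.1 p.397 («B₀(β) → ∞ if β → 1») + Thm 3.13 p.426 + Thm 3.12 p.423 + (3.42)–(3.43) pp.397–398; Balaban1984PropagatorsII, (2.51)–(2.56) pp.232–233] -/
theorem gXH_bHZKG_of_pins (hG : GeoOK (geo9K i)) {σ c : ℝ} (hrow : RowSum (toB6 (geo9K i) R₀ H₀) σ c)
    {𝔬 : Ops (geo9K i) B (XBK κ i) Y Z W} (𝔭 : HolderProbes (geo9K i) B (XBK κ i) Y (PK (FBondY i) (Fin (d + 1)) κ) PY)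
    {U : B.Cfg} (w : ℝ → ℝ) (hw0 : ∀ s, 0 ≤ w s) (hw1 : ∀ s, w s ≤ 1) {θ B₀ δ₀ δK ρ B₃ δ₃ BH : ℝ} {θH Bh : ℝ → ℝ}
    (hc : 0 ≤ c) (hθ : 0 ≤ θ) (hθH : ∀ s, 0 < s → s < 1 → 0 ≤ θH s) (hB₀ : 0 ≤ B₀) (hBh : ∀ s, 0 < s → s < 1 → 0 ≤ Bh s) (hBH : 0 ≤ BH)
    (hρ : 0 ≤ ρ) (hρS : ρ ≤ δ₀) (hρδ : ρ + σ ≤ δK) (hq : θ * c < 1)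
    (hwB : ∀ s, 0 < s → s < 1 → w s * (Bh s + θH s * (B₀ * (1 - θ * c)⁻¹) * c) ≤ BH)
    {bI : FBondY i → IBondY i}
    (hβ1f : ∀ f : FBondY i, (geomT i.D).dist (β i.hN i.D i.hk (bI f)) (blkV1 i.hN i.D f) ≤ 1)
    (hlev : ∀ f : FBondY i, lvl i.hN i.D i.hk (bI f) = (blkV1 i.hN i.D f).1.1) (hbI0 : ∀ f : FBondY i, bI f = bI ⟨f.src, 0⟩)
    (hcfk : i.cf = (((ℓ + 1 : ℕ) : ℝ)) ^ i.k)
    (hblk : 𝔬.blk = blkBK i bI) (hPX : 𝔭.blkPX = blkPK bI) (hΦ : ∀ s, 0 < s → s < 1 → 𝔭.ΦX U s = probeK b gt (wKA i s) (w₀K i s))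
    (hK : HasMaj (cNorm R₀ H₀ 𝔬.blk hG.lenle 1) (cNorm R₀ H₀ 𝔬.blk hG.lenle 1) (𝔬.G0 U ∘ₗ (𝔬.Tpi U + 𝔬.T2 U))
      (fun a b => θ * Real.exp (-(δK * (geo9K i).dist a b))))
    (he2 : HasMajorantHom (g := toB6 (geo9K i) R₀ H₀) 𝔬.blkY 𝔬.blk (𝔬.G0 U ∘ₗ 𝔬.Dstar U)
      (fun a b => B₀ * (geo9K i).len a * Real.exp (-(δ₀ * (geo9K i).dist a b))))
    (h43 : ∀ s, 0 < s → s < 1 → HasMajorantHom (g := toB6 (geo9K i) R₀ H₀) 𝔬.blkY 𝔭.blkPX (𝔭.ΦX U s ∘ₗ (𝔬.G0 U ∘ₗ 𝔬.Dstar U))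
      (fun (a b : (geo9K i).Site) => Bh s * (geo9K i).len a ^ (1 - s) * Real.exp (-(δ₀ * (geo9K i).dist a b))))
    (hpX : ∀ s, 0 < s → s < 1 → HasMaj (cNormR R₀ H₀ 𝔬.blk hG.lenle (-1)) (cNormR R₀ H₀ 𝔭.blkPX hG.lenle (s - 1))
      ((𝔭.ΦX U s ∘ₗ 𝔬.G0 U) ∘ₗ (𝔬.Tpi U + 𝔬.T2 U)) (fun a b => θH s * Real.exp (-(δK * (geo9K i).dist a b))))
    (hI : Identities 𝔬 U)
    (hB₃ : (((ℓ + 1 : ℕ) : ℝ)) * Real.exp (ρ * (rNear d ℓ + 1)) * (B₀ * (1 - θ * c)⁻¹ + BH) ≤ B₃) (hδ₃ : δ₃ ≤ ρ) :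
    HasMaj (cNorm R₀ H₀ 𝔬.blkY hG.lenle 0) (bHZKG (κ := κ) i b gt (R := R₀) (H := H₀) le_rfl w hw0 hw1) (𝔬.G1 U ∘ₗ 𝔬.Dstar U)
      (fun a b => B₃ * Real.exp (-(δ₃ * (geo9K i).dist a b))) := by
  have hL0 : (0 : ℝ) ≤ ((ℓ + 1 : ℕ) : ℝ) := Nat.cast_nonneg _
  have hinv : 0 ≤ (1 - θ * c)⁻¹ := inv_nonneg.mpr (by linarith)
  have hA₁ : 0 ≤ B₀ * (1 - θ * c)⁻¹ := mul_nonneg hB₀ hinv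
  set Λ : ℝ := (((ℓ + 1 : ℕ) : ℝ)) * Real.exp (ρ * (rNear d ℓ + 1)) with hΛ
  have hΛ0 : 0 ≤ Λ := by positivity
  -- member by member, then the graded landing with `w s·K s ≤ K₀`
  have hmem : ∀ (s : ℝ) (hs0 : 0 < s) (hs1 : s < 1),
      HasMaj (cNorm R₀ H₀ 𝔬.blkY hG.lenle 0) (bHZKT (κ := κ) i b gt (R := R₀) (H := H₀) (ε := s) (p := 1) hs0.le hs1.le (hs1.le.trans le_rfl))
        (𝔬.G1 U ∘ₗ 𝔬.Dstar U)
        (fun a a' => Λ * (B₀ * (1 - θ * c)⁻¹ + (Bh s + θH s * (B₀ * (1 - θ * c)⁻¹) * c)) * Real.exp (-(ρ * (geo9K i).dist a a'))) :=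
    fun s hs0 hs1 => gXH_bHZKT_of_pins i b gt hG hrow 𝔭 hs0.le hs1.le hc hθ (hθH s hs0 hs1) hB₀ (hBh s hs0 hs1) hρ hρS hρδ hq hβ1f hlev hbI0 hcfk
      hblk hPX (hΦ s hs0 hs1) hK he2 (h43 s hs0 hs1) (hpX s hs0 hs1) hI le_rfl le_rfl
  have hgr : HasMaj (cNorm R₀ H₀ 𝔬.blkY hG.lenle 0) (bHZKG (κ := κ) i b gt (R := R₀) (H := H₀) le_rfl w hw0 hw1) (𝔬.G1 U ∘ₗ 𝔬.Dstar U)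
      (fun a a' => Λ * (B₀ * (1 - θ * c)⁻¹ + BH) * Real.exp (-(ρ * (geo9K i).dist a a'))) := by
    refine hasMaj_into_bHZKG i b le_rfl w hw0 hw1 gt
      (K := fun s a a' => Λ * (B₀ * (1 - θ * c)⁻¹ + (Bh s + θH s * (B₀ * (1 - θ * c)⁻¹) * c)) * Real.exp (-(ρ * (geo9K i).dist a a')))
      (fun _ _ => by positivity) (fun s hs0 hs1 a a' => ?_) hmem
    have h1 : w s * (B₀ * (1 - θ * c)⁻¹) ≤ B₀ * (1 - θ * c)⁻¹ := mul_le_of_le_one_left hA₁ (hw1 s)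
    have h2 := hwB s hs0 hs1
    have he : 0 ≤ Λ * Real.exp (-(ρ * (geo9K i).dist a a')) := by positivity
    calc w s * (Λ * (B₀ * (1 - θ * c)⁻¹ + (Bh s + θH s * (B₀ * (1 - θ * c)⁻¹) * c)) * Real.exp (-(ρ * (geo9K i).dist a a')))
        = (w s * (B₀ * (1 - θ * c)⁻¹) + w s * (Bh s + θH s * (B₀ * (1 - θ * c)⁻¹) * c)) * (Λ * Real.exp (-(ρ * (geo9K i).dist a a'))) := by ring
      _ ≤ (B₀ * (1 - θ * c)⁻¹ + BH) * (Λ * Real.exp (-(ρ * (geo9K i).dist a a'))) := mul_le_mul_of_nonneg_right (add_le_add h1 h2) he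
      _ = _ := by ring
  have hC0 : 0 ≤ Λ * (B₀ * (1 - θ * c)⁻¹ + BH) := by positivity
  exact hasMaj_weaken hG hC0 (by rw [hΛ] at *; linarith) hδ₃ hgr

end Pins

end

end Literature.MathematicalPhysics.QuantumFieldTheory.Balaban1983to89.B9Thm313WholeCutLettersGXHAtPinsT
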